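import Mathlib
import Summits.Ventures.HodgeRepro.Tier4.Line4.SeesawPlaneData

/-!
# Tier4/Line4/SeesawPlaneDataDict — C-L4-PLANE-INSTANCE-DICT (plan-4 g8 S16454): the wall's (A1)+(A2) data from the face
datum ALONE, WITH THE DICTIONARY EXPOSED — the identity instance `a 1 = a 0`, `a 3 = a 2` and the two lines `e₁ e₂` behind the
scalars (`a 0 = ⟪e₁,e₁⟫_H`, `a 2 = −⟪e₂,e₂⟫_H`, `⟪e₁,e₂⟫_H = 0`, both self-pairings non-zero)

Blind re-derivation cell `pub-hodge-repro`, Tier 4 «prove the step» (README §9–§10), seat t4-L2-p1 (prover, LINE L2 nominal,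
service on LINE L4; gen 5; cut by name S16454, TAKEN S16455).  Tree path
`lean/Summits/Ventures/HodgeRepro/Tier4/Line4/SeesawPlaneDataDict.lean`.  Mathlib + the tree only: L1-p1 g5's SeesawPlaneData
p718424 (through it SeesawPlaneInstance p717649 — `seesawPlane_data_of_pair`'s construction, re-run here with the scalars
EXPOSED — and L1-p3 g5's SylvesterLines p717698 `exists_orthogonal_lines_of_sylvester`), SeesawScalars p716585 (`lineScalar`,
`algebraMap_lineScalar`, `algebraMap_neg_lineScalar`, `seesawDefinite_of_lines`), TraceZeroQuad p714383
(`exists_traceZero_describesCM`), CMPlaceBridge (`isCMAt_of_describesCM`), AnisotropicLines p716230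
(`hform_self_ne_zero_of_anisotropic`); no printed input; no definition; no instance.

WHAT IS PROVED.  **`exists_seesawPlane_data_dict_of_targetData (d : TargetData F E)`**: the conjuncts of
`exists_seesawPlane_data_of_targetData` VERBATIM — a trace-zero `q` describing `E/E⁺` (the unfolded `DescribesCM` clause),
scalars `a` with `a i ≠ 0`, `0 < Re τ₀(a i)`, and the (8) carrier `SeesawDefinite q a (mk (τ₀ ∘ ι))` — PLUS five clauses the
instance theorem of record left implicit: `a 1 = a 0`, `a 3 = a 2` (the identity instance of the second plane: the wall's
`_hiso : 1 * B(a 1, a 3) * 1ᵀ = 1 • B(a 0, a 2)` is then `B(a 1, a 3) = B(a 0, a 2)`, `one_mul`, `mul_one`, `one_smul`), and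
the face-to-plane DICTIONARY in `l4_wall_data_exist`'s spelling: two lines `e₁ e₂ : Fin 3 → E` with `⟪e₁,e₂⟫_H = 0`,
`ι (a 0) = ⟪e₁,e₁⟫_H`, `ι (a 2) = −⟪e₂,e₂⟫_H`, `⟪e₁,e₁⟫_H ≠ 0`, `⟪e₂,e₂⟫_H ≠ 0`.  The witnesses are L1-p1's:
`q = ⟨0, n⟩` (TraceZeroQuad), `a = ![ℓ₁, ℓ₁, −ℓ₂, −ℓ₂]` with `ℓᵢ = lineScalar d.hH eᵢ` (`ι ℓᵢ = ⟪eᵢ,eᵢ⟫_H` by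
`algebraMap_lineScalar`, definitionally), `e₁ e₂` the Sylvester pair of `d.H d.hH d.τ₀ d.C d.hC`; the five extra clauses are
`rfl` (`a 1 = a 0`, `a 3 = a 2`), the pair's `horth`, `algebraMap_lineScalar` / `algebraMap_neg_lineScalar`, and
`hform_self_ne_zero_of_anisotropic` from `d.hani` and `e₁ e₂ ≠ 0`.

RECORD it buys (plan-4 S16454): at the plane instance of record the wall's (A3) binder `_hiso` is BY NAME from `a 1 = a 0`,
`a 3 = a 2`; `hA : IsAnisotropic (seesawPlane …)` is BY NAME through SeesawAnisotropic's dictionary (`a 0 = ⟪e₁,e₁⟫_H`,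
`a 2 = −⟪e₂,e₂⟫_H`, `q = ⟨0, n⟩`); `l4_wall_data_exist`'s dictionary binders `e₁ e₂ horth ha0 ha2 h₁ h₂` are inhabited from
`d`.  Nothing here chooses the planes the mixed classes live on ((A3) between two DIFFERENT planes stays OPEN), and nothing
here says anything about the status of the Hodge conjecture for CM abelian varieties, which is NOT proved (HC_CM is NOT
proved by anyone in this repository).
-/

set_option autoImplicit false

noncomputable section

namespace Summit.Ventures.HodgeRepro.Tier4.Line4

open Summit.Ventures.HodgeRepro.Tier4 Summit.Ventures.HodgeRepro.Tier4.Common NumberField Matrix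

section Dict

variable {F E : Type} [Field F] [NumberField F] [IsGalois ℚ F] [IsCMField F]
  [Field E] [NumberField E] [IsGalois ℚ E] [IsCMField E]

/-- **C-L4-PLANE-INSTANCE-DICT from a given pair of lines**: `seesawPlane_data_of_pair` with the scalars EXPOSED —
`a = ![⟪e₁,e₁⟫, ⟪e₁,e₁⟫, −⟪e₂,e₂⟫, −⟪e₂,e₂⟫]`, so `a 1 = a 0`, `a 3 = a 2`, `ι (a 0) = ⟪e₁,e₁⟫_H`, `ι (a 2) = −⟪e₂,e₂⟫_H`,
and the two self-pairings are non-zero (`d.hani`). -/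
theorem seesawPlane_data_dict_of_pair (d : TargetData F E) (e₁ e₂ : Fin 3 → E) (h₁ : e₁ ≠ 0) (h₂ : e₂ ≠ 0)
    (horth : hform (IsCMField.complexConj E).toRingEquiv d.H e₁ e₂ = 0)
    (hpos₁ : 0 < (d.τ₀ (hform (IsCMField.complexConj E).toRingEquiv d.H e₁ e₁)).re)
    (hneg₂ : (d.τ₀ (hform (IsCMField.complexConj E).toRingEquiv d.H e₂ e₂)).re < 0) :
    ∃ (q : QuadData ↥(maximalRealSubfield E)) (a : Fin 4 → ↥(maximalRealSubfield E)),
      q.t = 0 ∧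
      (∃ ω : E, ω ^ 2 = algebraMap ↥(maximalRealSubfield E) E q.t * ω - algebraMap ↥(maximalRealSubfield E) E q.n ∧
        IsCMField.complexConj E ω = algebraMap ↥(maximalRealSubfield E) E q.t - ω ∧
        IsCMField.complexConj E ω ≠ ω) ∧
      (∀ i, a i ≠ 0) ∧
      (∀ i, 0 < (d.τ₀ (algebraMap ↥(maximalRealSubfield E) E (a i))).re) ∧
      SeesawDefinite q a (InfinitePlace.mk (d.τ₀.comp (algebraMap ↥(maximalRealSubfield E) E))) ∧
      a 1 = a 0 ∧ a 3 = a 2 ∧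
      algebraMap ↥(maximalRealSubfield E) E (a 0) = hform (IsCMField.complexConj E).toRingEquiv d.H e₁ e₁ ∧
      algebraMap ↥(maximalRealSubfield E) E (a 2) = -hform (IsCMField.complexConj E).toRingEquiv d.H e₂ e₂ ∧
      hform (IsCMField.complexConj E).toRingEquiv d.H e₁ e₁ ≠ 0 ∧
      hform (IsCMField.complexConj E).toRingEquiv d.H e₂ e₂ ≠ 0 := by
  obtain ⟨n, hq⟩ := exists_traceZero_describesCM E
  set a : Fin 4 → ↥(maximalRealSubfield E) :=
    ![lineScalar d.hH e₁, lineScalar d.hH e₁, -lineScalar d.hH e₂, -lineScalar d.hH e₂] with ha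
  have hf₁ : hform (IsCMField.complexConj E).toRingEquiv d.H e₁ e₁ ≠ 0 :=
    hform_self_ne_zero_of_anisotropic _ d.H d.hani h₁
  have hf₂ : hform (IsCMField.complexConj E).toRingEquiv d.H e₂ e₂ ≠ 0 :=
    hform_self_ne_zero_of_anisotropic _ d.H d.hani h₂
  have hne₁ : lineScalar d.hH e₁ ≠ 0 := by
    intro h0
    have := congrArg (algebraMap ↥(maximalRealSubfield E) E) h0
    rw [algebraMap_lineScalar, map_zero] at this
    exact hf₁ this
  have hne₂ : lineScalar d.hH e₂ ≠ 0 := by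
    intro h0
    have := congrArg (algebraMap ↥(maximalRealSubfield E) E) h0
    rw [algebraMap_lineScalar, map_zero] at this
    exact hf₂ this
  have hneg₂' : 0 < (d.τ₀ (algebraMap ↥(maximalRealSubfield E) E (-lineScalar d.hH e₂))).re := by
    rw [algebraMap_neg_lineScalar, map_neg, Complex.neg_re]
    linarith
  refine ⟨⟨0, n⟩, a, rfl, hq, ?_, ?_, ?_, rfl, rfl, ?_, ?_, hf₁, hf₂⟩
  · intro i
    fin_cases i
    · exact hne₁
    · exact hne₁
    · exact neg_ne_zero.2 hne₂
    · exact neg_ne_zero.2 hne₂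
  · intro i
    fin_cases i
    · exact hpos₁
    · exact hpos₁
    · exact hneg₂'
    · exact hneg₂'
  · exact seesawDefinite_of_lines d.H d.hH d.τ₀ d.hdef d.hani ⟨0, n⟩ (isCMAt_of_describesCM ⟨0, n⟩ hq) e₁ e₂ h₁ h₂
      horth a rfl rfl
  · exact algebraMap_lineScalar d.hH e₁
  · exact algebraMap_neg_lineScalar d.hH e₂

/-- **C-L4-PLANE-INSTANCE-DICT**: the wall's `(q, a)` from the face datum ALONE with the dictionary exposed — the conjuncts of
`exists_seesawPlane_data_of_targetData` verbatim, plus `a 1 = a 0`, `a 3 = a 2` (the identity instance of the second plane)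
and the two `H`-orthogonal lines `e₁ e₂` behind the scalars (`ι (a 0) = ⟪e₁,e₁⟫_H`, `ι (a 2) = −⟪e₂,e₂⟫_H`, both
self-pairings non-zero); the pair is L1-p3's Sylvester pair of `d.H d.hH d.τ₀ d.C d.hC`. -/
theorem exists_seesawPlane_data_dict_of_targetData (d : TargetData F E) :
    ∃ (q : QuadData ↥(maximalRealSubfield E)) (a : Fin 4 → ↥(maximalRealSubfield E)) (e₁ e₂ : Fin 3 → E),
      q.t = 0 ∧
      (∃ ω : E, ω ^ 2 = algebraMap ↥(maximalRealSubfield E) E q.t * ω - algebraMap ↥(maximalRealSubfield E) E q.n ∧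
        IsCMField.complexConj E ω = algebraMap ↥(maximalRealSubfield E) E q.t - ω ∧
        IsCMField.complexConj E ω ≠ ω) ∧
      (∀ i, a i ≠ 0) ∧
      (∀ i, 0 < (d.τ₀ (algebraMap ↥(maximalRealSubfield E) E (a i))).re) ∧
      SeesawDefinite q a (InfinitePlace.mk (d.τ₀.comp (algebraMap ↥(maximalRealSubfield E) E))) ∧
      a 1 = a 0 ∧ a 3 = a 2 ∧
      hform (IsCMField.complexConj E).toRingEquiv d.H e₁ e₂ = 0 ∧
      algebraMap ↥(maximalRealSubfield E) E (a 0) = hform (IsCMField.complexConj E).toRingEquiv d.H e₁ e₁ ∧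
      algebraMap ↥(maximalRealSubfield E) E (a 2) = -hform (IsCMField.complexConj E).toRingEquiv d.H e₂ e₂ ∧
      hform (IsCMField.complexConj E).toRingEquiv d.H e₁ e₁ ≠ 0 ∧
      hform (IsCMField.complexConj E).toRingEquiv d.H e₂ e₂ ≠ 0 := by
  obtain ⟨e₁, e₂, h₁, h₂, horth, hpos₁, hneg₂⟩ := exists_orthogonal_lines_of_sylvester d.H d.hH d.τ₀ d.C d.hC
  obtain ⟨q, a, ht, hq, ha, hpos, hdef, h10, h32, ha0, ha2, hf₁, hf₂⟩ :=
    seesawPlane_data_dict_of_pair d e₁ e₂ h₁ h₂ horth hpos₁ hneg₂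
  exact ⟨q, a, e₁, e₂, ht, hq, ha, hpos, hdef, h10, h32, horth, ha0, ha2, hf₁, hf₂⟩

end Dict

end Summit.Ventures.HodgeRepro.Tier4.Line4

end
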